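import Literature.RepresentationTheory.ClassicalInvariants.SymmetricGroupHarmonicsDimension
import Mathlib.LinearAlgebra.Vandermonde
import Mathlib.Algebra.MvPolynomial.Division
import Mathlib.Algebra.MvPolynomial.Nilpotent
import Mathlib.Algebra.BigOperators.Associated
import HarnessLib

/-!
# `𝔖ₙ`-harmonic polynomials are the derivatives of `Δ = ∏ (xⱼ − xᵢ)` (Goodman–Wallach, Theorem 5.1.8)

Goodman–Wallach, *Symmetry, Representations, and Invariants* (GTM 255), § 5.1.2, Theorem 5.1.8 and
Lemma 5.1.9 with their printed proofs (pp. 236–237) [GoodmanWallachGTM255].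

Setting (as in `SymmetricGroupHarmonics`, `SymmetricGroupHarmonicsDimension`): `𝒫 = ℝ[x₁,…,xₙ]`
(`MvPolynomial (Fin n) ℝ`), `𝔖ₙ` acting by `rename`, `𝒥` the symmetric polynomials,
`S = {g ∈ 𝒥 : g homogeneous of positive degree}` (so `𝒫𝒥₊ = Ideal.span S`), `f ↦ ∂(f)` the algebra
homomorphism to constant-coefficient differential operators (hypotheses `D`, `hD : D (X i) = ∂ᵢ`),
`ℋ = ⨅_{g ∈ S} ker ∂(g)` the `𝔖ₙ`-harmonic polynomials, and
`Δ = ∏_{i<j} (xⱼ − xᵢ) = det [xᵢ^j]` (Mathlib's orientation of the Vandermonde determinant,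
`Matrix.det_vandermonde`; the book writes `∏_{i<j} (xᵢ − xⱼ) = ± Δ` — every statement below is
insensitive to the sign).

Contents (book locators in the docstrings):
* § 1 `Δ`: `prod_X_sub_X_eq_det_vandermonde`, **`rename_prod_X_sub_X`** (`ρ(s)Δ = sgn(s)Δ`: "`Δ` is
  skew invariant", via `Matrix.det_permute`), `prod_X_sub_X_isHomogeneous` + `sum_card_Ioi_eq`
  (`deg Δ = n(n−1)/2`), `prod_X_sub_X_ne_zero`.
* § 2 divisibility: `prime_X_sub_X`, `X_sub_X_dvd_of_rename_swap_eq_neg` ("a skew-invariant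
  polynomial is divisible by `xᵢ − xⱼ`"), **`prod_X_sub_X_dvd_of_skew`** ("hence `Δ` divides `g`";
  the `xⱼ − xᵢ` are pairwise non-associated primes).
* § 3 the operators `∂(g)`: `rename_apply` (`𝔖ₙ`-equivariance `ρ(s)(∂(f)p) = ∂(ρ(s)f)(ρ(s)p)`),
  `isHomogeneous_apply` / `apply_eq_zero_of_lt` (`∂(𝒫ᵐ)𝒫ᵏ ⊆ 𝒫ᵏ⁻ᵐ`, via the Fischer pairing),
  `eq_zero_of_skew_of_lt`, **`prod_X_sub_X_mem_harmonic`** (`Δ ∈ ℋ`), `apply_mem_harmonic`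
  (`ℰ ⊆ ℋ`), `apply_eq_zero_of_mem_span` (`∂(𝒫𝒥₊)Δ = 0`), `apply_prod_X_sub_X_self_ne_zero`
  (`∂(Δ)Δ = ⟨Δ | Δ⟩ ≠ 0`).
* § 4 **Lemma 5.1.9** `mem_span_of_apply_prod_X_sub_X_eq_zero` (`g ∈ 𝒫ᵐ`, `∂(g)Δ = 0 ⇒ g ∈ 𝒫𝒥₊`)
  with its printed steps `add_rename_swap_mem_span_of_mul_mem` ((5.12) for transpositions),
  `sub_sign_smul_rename_mem_span` ((5.12) for all `s`), `mem_span_of_forall_add_rename_swap_mem`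
  (the skew average `h = φΔ`); **Theorem 5.1.8** `eq_zero_of_mem_harmonic_of_apply_eq_zero`
  (`h ↦ ∂(h)Δ` is injective on `ℋ`), `mem_harmonic_iff_exists_apply_prod_X_sub_X`
  (`ℋ = {∂(g)Δ : g ∈ 𝒫}`), `harmonic_eq_span_apply_monomial_prod_X_sub_X` (`ℋ = Span{∂(x^α)Δ}`:
  "`ℋ` is spanned by `Δ` and its partial derivatives of all orders"), and the top degree
  `homogeneousSubmodule_inf_harmonic_eq_span_prod_X_sub_X` (`ℋ^{n(n−1)/2} = ℝΔ`: "a unique (up to a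
  constant multiple) polynomial in `ℋ` of degree `n(n−1)/2`"), `coeff_prod_geom_sum_top`.

Everything is over `ℝ` (the book works over `ℂ`; the statements and proofs are field-independent in
characteristic `0`, and the Fischer form of `Literature.Algebra.Polynomial.FischerInnerProduct` is
real). No new definitions: `S`, `ℋ`, `Δ` are written out in each statement, as in the sibling files.

References: R. Goodman, N. R. Wallach, GTM 255, Springer 2009, § 5.1.2, Theorem 5.1.8, Lemma 5.1.9
[GoodmanWallachGTM255].
-/

open MvPolynomial
open scoped BigOperators

namespace Literature.RepresentationTheory.ClassicalInvariants.SymmetricGroupHarmonicsVandermonde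

open Literature.Algebra.Polynomial
open Literature.Algebra.Polynomial.FischerDecomposition
open Literature.RepresentationTheory.ClassicalInvariants.SymmetricGroupHarmonics
open Literature.RepresentationTheory.ClassicalInvariants.SymmetricGroupHarmonicsDimension

noncomputable section

/-! ## § 1. The Vandermonde product `Δ = ∏_{i<j} (xⱼ − xᵢ)` is skew invariant -/

/-- `Δ = ∏_{i<j} (xⱼ − xᵢ)` is the Vandermonde determinant `det [xᵢ^j]`.
[cite: GoodmanWallachGTM255, Theorem 5.1.8 (Δ(x) = ∏_{i<j}(x_i − x_j))] -/
theorem prod_X_sub_X_eq_det_vandermonde (n : ℕ) :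
    (∏ i : Fin n, ∏ j ∈ Finset.Ioi i, (X j - X i : MvPolynomial (Fin n) ℝ)) =
      (Matrix.vandermonde fun i : Fin n => (X i : MvPolynomial (Fin n) ℝ)).det :=
  (Matrix.det_vandermonde _).symm

/-- **`Δ` is skew invariant**: `ρ(s)Δ = sgn(s) Δ` for every `s ∈ 𝔖ₙ`.
[cite: GoodmanWallachGTM255, Theorem 5.1.8 (proof: "ρ(s)Δ(x) = sgn(s)Δ(x) for all s ∈ 𝔖ₙ")] -/
theorem rename_prod_X_sub_X {n : ℕ} (σ : Equiv.Perm (Fin n)) :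
    rename σ (∏ i : Fin n, ∏ j ∈ Finset.Ioi i, (X j - X i : MvPolynomial (Fin n) ℝ)) =
      ((Equiv.Perm.sign σ : ℤ) : ℝ) • ∏ i : Fin n, ∏ j ∈ Finset.Ioi i, (X j - X i) := by
  rw [prod_X_sub_X_eq_det_vandermonde]
  have hmap : (rename σ : MvPolynomial (Fin n) ℝ →ₐ[ℝ] MvPolynomial (Fin n) ℝ).toRingHom.mapMatrix
      (Matrix.vandermonde fun i : Fin n => (X i : MvPolynomial (Fin n) ℝ)) =
      (Matrix.vandermonde fun i : Fin n => (X i : MvPolynomial (Fin n) ℝ)).submatrix σ id := by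
    ext i j
    simp [Matrix.vandermonde_apply, rename_X]
  rw [show rename σ (Matrix.vandermonde fun i : Fin n => (X i : MvPolynomial (Fin n) ℝ)).det =
      (rename σ : MvPolynomial (Fin n) ℝ →ₐ[ℝ] MvPolynomial (Fin n) ℝ).toRingHom
        (Matrix.vandermonde fun i : Fin n => (X i : MvPolynomial (Fin n) ℝ)).det from rfl,
    RingHom.map_det, hmap, Matrix.det_permute, MvPolynomial.smul_eq_C_mul, ← map_intCast (C (σ := Fin n) (R := ℝ))]

/-- `Δ` is homogeneous (of degree `Σᵢ #{j > i} = n(n−1)/2`). [cite: GoodmanWallachGTM255, Corollary 5.1.7 / Theorem 5.1.8 (Δ has degree n(n−1)/2)] -/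
theorem prod_X_sub_X_isHomogeneous (n : ℕ) :
    (∏ i : Fin n, ∏ j ∈ Finset.Ioi i, (X j - X i : MvPolynomial (Fin n) ℝ)).IsHomogeneous
      (∑ i : Fin n, (Finset.Ioi i).card) := by
  refine IsHomogeneous.prod _ _ _ fun i _ => ?_
  rw [Finset.card_eq_sum_ones]
  exact IsHomogeneous.prod _ _ _ fun j _ => (isHomogeneous_X ℝ j).sub (isHomogeneous_X ℝ i)

/-- `deg Δ = n(n−1)/2`. [cite: GoodmanWallachGTM255, Corollary 5.1.7 (p_ℋ(t) = t^{n(n−1)/2} + ⋯)] -/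
theorem sum_card_Ioi_eq (n : ℕ) : ∑ i : Fin n, (Finset.Ioi i).card = n * (n - 1) / 2 := by
  simp_rw [Fin.card_Ioi]
  have h1 : ∑ i : Fin n, (n - 1 - (i : ℕ)) = ∑ i ∈ Finset.range n, (n - 1 - i) :=
    Fin.sum_univ_eq_sum_range (fun i => n - 1 - i) n
  rw [h1, Finset.sum_range_reflect (fun i => i) n, ← Finset.sum_range_id_mul_two n,
    Nat.mul_div_cancel _ two_pos]

/-- `Δ ≠ 0`. [cite: GoodmanWallachGTM255, Theorem 5.1.8 (proof)] -/
theorem prod_X_sub_X_ne_zero (n : ℕ) :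
    (∏ i : Fin n, ∏ j ∈ Finset.Ioi i, (X j - X i : MvPolynomial (Fin n) ℝ)) ≠ 0 := by
  refine Finset.prod_ne_zero_iff.mpr fun i _ => Finset.prod_ne_zero_iff.mpr fun j hj => ?_
  rw [Finset.mem_Ioi] at hj
  exact sub_ne_zero.mpr fun h => (ne_of_gt hj) (X_injective h)

/-! ## § 2. Skew-invariant polynomials are divisible by `Δ` -/

section general

variable {ι : Type*} [DecidableEq ι]

/-- `xᵢ − xⱼ` is a prime element of `ℝ[x]` for `i ≠ j` (it is the image of the prime `xᵢ` under the
automorphism `xᵢ ↦ xᵢ − xⱼ`). [cite: GoodmanWallachGTM255, Theorem 5.1.8 (proof: "g(x) is divisible by x_i − x_j for every i ≠ j … Hence Δ(x) divides g(x)")] -/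
theorem prime_X_sub_X {i j : ι} (hij : i ≠ j) : Prime (X i - X j : MvPolynomial ι ℝ) := by
  let φ : MvPolynomial ι ℝ →ₐ[ℝ] MvPolynomial ι ℝ :=
    aeval fun k => if k = i then X i - X j else X k
  let ψ : MvPolynomial ι ℝ →ₐ[ℝ] MvPolynomial ι ℝ :=
    aeval fun k => if k = i then X i + X j else X k
  have hφψ : φ.comp ψ = AlgHom.id ℝ _ := by
    refine algHom_ext fun k => ?_
    by_cases hk : k = i
    · subst hk
      simp [φ, ψ, if_neg hij.symm]
    · simp [φ, ψ, if_neg hk]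
  have hψφ : ψ.comp φ = AlgHom.id ℝ _ := by
    refine algHom_ext fun k => ?_
    by_cases hk : k = i
    · subst hk
      simp [φ, ψ, if_neg hij.symm]
    · simp [φ, ψ, if_neg hk]
  let e : MvPolynomial ι ℝ ≃ₐ[ℝ] MvPolynomial ι ℝ := AlgEquiv.ofAlgHom φ ψ hφψ hψφ
  have he : e (X i) = X i - X j := by
    show φ (X i) = X i - X j
    simp [φ]
  rw [← he]
  exact (MulEquiv.prime_iff e).mpr X_prime

/-- **A polynomial that is skew under the transposition `(i j)` is divisible by `xᵢ − xⱼ`** ("since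
`g(x)` vanishes on the hyperplane `xᵢ = xⱼ`"; here via the divided difference
`xᵢ − xⱼ ∣ g − ρ(s)g = 2g`). [cite: GoodmanWallachGTM255, Theorem 5.1.8 (proof)] -/
theorem X_sub_X_dvd_of_rename_swap_eq_neg {i j : ι} {g : MvPolynomial ι ℝ}
    (hg : rename (Equiv.swap i j) g = -g) : X i - X j ∣ g := by
  have h := X_sub_X_dvd_sub_rename_swap i j g
  rw [hg, sub_neg_eq_add, ← two_smul ℝ g, MvPolynomial.smul_eq_C_mul] at h
  have h2 : g = C (2⁻¹ : ℝ) * (C (2 : ℝ) * g) := by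
    rw [← mul_assoc, ← C_mul, inv_mul_cancel₀ (two_ne_zero), C_1, one_mul]
  rw [h2]
  exact h.mul_left _

/-- Two of the linear forms `xⱼ − xᵢ`, `x_l − x_k` (`i ≠ j`, `k ≠ l`) are associated only if
`{i, j} = {k, l}`. [folklore] -/
private theorem coeff_single_X (j m : ι) :
    coeff (Finsupp.single m 1) (X j : MvPolynomial ι ℝ) = if j = m then 1 else 0 := by
  rw [coeff_X]
  exact if_congr (Finsupp.single_left_inj one_ne_zero) rfl rfl

/-- Two of the linear forms `xⱼ − xᵢ`, `x_l − x_k` (`i ≠ j`) are associated only if `{i, j} = {k, l}`.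
[folklore] -/
private theorem eq_of_associated_X_sub_X {i j k l : ι} (hij : i ≠ j)
    (h : Associated (X j - X i : MvPolynomial ι ℝ) (X l - X k)) :
    (i = k ∧ j = l) ∨ (i = l ∧ j = k) := by
  obtain ⟨u, hu⟩ := h
  obtain ⟨c, -, hc⟩ := (isUnit_iff_eq_C_of_isReduced (R := ℝ)).mp u.isUnit
  have hc0 : c ≠ 0 := fun h0 => u.ne_zero (by rw [hc, h0, C_0])
  rw [hc, mul_comm] at hu
  -- compare the coefficients of `x_m` on both sides of `c (xⱼ − xᵢ) = x_l − x_k`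
  have key : ∀ m : ι, c * ((if j = m then 1 else 0) - (if i = m then 1 else 0)) =
      (if l = m then (1 : ℝ) else 0) - (if k = m then 1 else 0) := by
    intro m
    have := congrArg (coeff (Finsupp.single m 1)) hu
    rwa [coeff_C_mul, coeff_sub, coeff_sub, coeff_single_X, coeff_single_X, coeff_single_X,
      coeff_single_X] at this
  have hj := key j
  have hi := key i
  rw [if_pos rfl, if_neg hij] at hj
  rw [if_pos rfl, if_neg hij.symm] at hi
  by_cases hlj : l = j
  · subst hlj
    rw [if_pos rfl, if_neg hij.symm] at *
    by_cases hkl : k = l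
    · subst hkl
      exact absurd (by simpa using hj) hc0
    · rw [if_neg hkl] at hj
      by_cases hki : k = i
      · exact Or.inl ⟨hki.symm, rfl⟩
      · rw [if_neg hki] at hi
        exfalso
        have : c = 1 := by linarith
        subst this
        norm_num at hi
  · rw [if_neg hlj] at hj
    by_cases hkj : k = j
    · subst hkj
      rw [if_pos rfl] at hj
      rw [if_neg hij.symm] at hi
      by_cases hli : l = i
      · exact Or.inr ⟨hli.symm, rfl⟩
      · rw [if_neg hli] at hi
        exfalso
        have : c = -1 := by linarith
        subst this
        norm_num at hi
    · rw [if_neg hkj] at hj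
      exfalso
      exact hc0 (by simpa using hj)

end general

/-- **Every skew-invariant polynomial is divisible by `Δ`**: if `ρ(s)g = sgn(s)g` for all `s ∈ 𝔖ₙ`
then `Δ ∣ g` (each `xⱼ − xᵢ` divides `g`, and these are pairwise non-associated primes).
[cite: GoodmanWallachGTM255, Theorem 5.1.8 (proof: "Hence Δ(x) divides g(x)")] -/
theorem prod_X_sub_X_dvd_of_skew {n : ℕ} {g : MvPolynomial (Fin n) ℝ}
    (hg : ∀ σ : Equiv.Perm (Fin n), rename σ g = ((Equiv.Perm.sign σ : ℤ) : ℝ) • g) :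
    (∏ i : Fin n, ∏ j ∈ Finset.Ioi i, (X j - X i : MvPolynomial (Fin n) ℝ)) ∣ g := by
  classical
  -- the product over pairs `i < j` as a product over a finset of pairs
  set P : Finset (Fin n × Fin n) := Finset.univ.filter fun p => p.1 < p.2 with hP
  have hprod : (∏ i : Fin n, ∏ j ∈ Finset.Ioi i, (X j - X i : MvPolynomial (Fin n) ℝ)) =
      ∏ p ∈ P, (X p.2 - X p.1 : MvPolynomial (Fin n) ℝ) := by
    exact (Finset.prod_finset_product' (f := fun i j : Fin n => (X j - X i : MvPolynomial (Fin n) ℝ)) P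
      Finset.univ (fun i => Finset.Ioi i) fun p => by simp [hP, Finset.mem_Ioi]).symm
  rw [hprod, Finset.prod_eq_multiset_prod P fun p : Fin n × Fin n => (X p.2 - X p.1 : MvPolynomial (Fin n) ℝ)]
  refine Multiset.prod_primes_dvd g ?_ ?_ ?_
  · intro a ha
    obtain ⟨p, hp, rfl⟩ := Multiset.mem_map.mp ha
    have hp' : p.1 < p.2 := by simpa [hP] using hp
    exact prime_X_sub_X (ne_of_gt hp')
  · intro a ha
    obtain ⟨p, hp, rfl⟩ := Multiset.mem_map.mp ha
    have hp' : p.1 < p.2 := by simpa [hP] using hp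
    refine X_sub_X_dvd_of_rename_swap_eq_neg ?_
    rw [hg, Equiv.Perm.sign_swap (ne_of_gt hp'), Units.val_neg, Units.val_one, Int.cast_neg,
      Int.cast_one, neg_one_smul]
  · intro a
    rw [Multiset.countP_map]
    change (P.filter fun p => Associated a (X p.2 - X p.1)).val.card ≤ 1
    rw [Finset.card_val, Finset.card_le_one]
    intro p hp q hq
    rw [Finset.mem_filter] at hp hq
    have hp' : p.1 < p.2 := by simpa [hP] using hp.1
    have hq' : q.1 < q.2 := by simpa [hP] using hq.1
    rcases eq_of_associated_X_sub_X (ne_of_lt hp') (hp.2.symm.trans hq.2) with ⟨h1, h2⟩ | ⟨h1, h2⟩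
    · exact Prod.ext h1 h2
    · exfalso
      rw [← h1, ← h2] at hq'
      exact lt_asymm hp' hq'

/-! ## § 3. The operators `∂(g)`: `𝔖ₙ`-equivariance, degree, and `Δ ∈ ℋ` -/

section operators

variable {ι : Type*} [Fintype ι] [DecidableEq ι]

omit [Fintype ι] [DecidableEq ι] in
/-- **`𝔖ₙ`-equivariance of `f ↦ ∂(f)`**: `ρ(s)(∂(f)p) = ∂(ρ(s)f)(ρ(s)p)`; in particular `∂(f)Δ` is skew
invariant for invariant `f`. [cite: GoodmanWallachGTM255, Theorem 5.1.8 (proof: "g(x) = ∂(f)Δ(x) is skew invariant, since f is invariant")] -/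
theorem rename_apply (D : MvPolynomial ι ℝ →ₐ[ℝ] Module.End ℝ (MvPolynomial ι ℝ))
    (hD : ∀ i, D (X i) =
      ((pderiv i : Derivation ℝ (MvPolynomial ι ℝ) (MvPolynomial ι ℝ)) :
        Module.End ℝ (MvPolynomial ι ℝ)))
    (σ : Equiv.Perm ι) (f p : MvPolynomial ι ℝ) :
    rename σ (D f p) = D (rename σ f) (rename σ p) := by
  induction f using MvPolynomial.induction_on generalizing p with
  | C a =>
    have e1 : ∀ q : MvPolynomial ι ℝ, D (C a) q = a • q := fun q => by
      rw [← MvPolynomial.algebraMap_eq, AlgHom.commutes, Module.algebraMap_end_apply]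
    rw [rename_C, e1, e1, map_smul]
  | add f g hf hg =>
    simp only [map_add, LinearMap.add_apply, hf, hg]
  | mul_X f i hf =>
    have hDX : ∀ (k : ι) (q : MvPolynomial ι ℝ), D (X k) q = pderiv k q := fun k q => by
      rw [hD]; rfl
    rw [map_mul, Module.End.mul_apply, hDX, hf, map_mul (rename σ) f (X i), rename_X, map_mul,
      Module.End.mul_apply, hDX, pderiv_rename σ.injective]

/-- The homogeneous components of `∂(g)p` (`g ∈ 𝒫ᵐ`, `p ∈ 𝒫ᵏ`) of degree `≠ k − m` vanish: they are
Fischer-orthogonal to themselves, by `⟨q | ∂(g)p⟩ = ⟨qg | p⟩` and the orthogonality of distinct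
degrees. [cite: GoodmanWallachGTM255, Lemma 5.1.5 (proof) / Theorem 5.1.8 (proof: "g(x) has degree less than the degree of Δ(x)")] -/
theorem homogeneousComponent_apply_eq_zero (D : MvPolynomial ι ℝ →ₐ[ℝ] Module.End ℝ (MvPolynomial ι ℝ))
    (hD : ∀ i, D (X i) =
      ((pderiv i : Derivation ℝ (MvPolynomial ι ℝ) (MvPolynomial ι ℝ)) :
        Module.End ℝ (MvPolynomial ι ℝ)))
    {g p : MvPolynomial ι ℝ} {m k : ℕ} (hg : g.IsHomogeneous m) (hp : p.IsHomogeneous k) {l : ℕ}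
    (hl : l + m ≠ k) : homogeneousComponent l (D g p) = 0 := by
  set q := homogeneousComponent l (D g p) with hq
  have hqh : q.IsHomogeneous l := homogeneousComponent_isHomogeneous l _
  have h1 : fischerInner q (D g p) = fischerInner q q := by
    conv_lhs => rw [← sum_homogeneousComponent (D g p)]
    rw [fischerInner_sum_right, Finset.sum_eq_single l]
    · intro b _ hb
      exact fischerInner_eq_zero_of_isHomogeneous_of_ne hqh (homogeneousComponent_isHomogeneous b _)
        (Ne.symm hb)
    · intro hlr
      rw [Finset.mem_range, not_lt] at hlr
      rw [homogeneousComponent_eq_zero l _ (by omega), fischerInner_zero_right]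
  have h2 : fischerInner q (D g p) = 0 := by
    rw [fischerInner_apply_right D hD, fischerInner_eq_zero_of_isHomogeneous_of_ne (hqh.mul hg) hp hl]
  exact (fischerInner_self_eq_zero_iff q).mp (h1.symm.trans h2)

/-- **`∂(𝒫ᵐ)𝒫ᵏ ⊆ 𝒫ᵏ⁻ᵐ`**: `∂(g)p` is homogeneous of degree `k − m` for `g ∈ 𝒫ᵐ`, `p ∈ 𝒫ᵏ`.
[cite: GoodmanWallachGTM255, Theorem 5.1.8 (proof) / proof of Theorem 5.1.8 ("since Δ is homogeneous we have ∂(h_m)Δ = 0 for all m")] -/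
theorem isHomogeneous_apply (D : MvPolynomial ι ℝ →ₐ[ℝ] Module.End ℝ (MvPolynomial ι ℝ))
    (hD : ∀ i, D (X i) =
      ((pderiv i : Derivation ℝ (MvPolynomial ι ℝ) (MvPolynomial ι ℝ)) :
        Module.End ℝ (MvPolynomial ι ℝ)))
    {g p : MvPolynomial ι ℝ} {m k : ℕ} (hg : g.IsHomogeneous m) (hp : p.IsHomogeneous k) :
    (D g p).IsHomogeneous (k - m) := by
  rw [← sum_homogeneousComponent (D g p)]
  refine IsHomogeneous.sum _ _ _ fun l _ => ?_
  by_cases hlk : l = k - m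
  · rw [hlk]
    exact homogeneousComponent_isHomogeneous _ _
  · rw [homogeneousComponent_apply_eq_zero D hD hg hp (l := l) (by omega)]
    exact isHomogeneous_zero _ _ _

/-- `∂(g)p = 0` for `g ∈ 𝒫ᵐ`, `p ∈ 𝒫ᵏ`, `k < m`. [cite: GoodmanWallachGTM255, Theorem 5.1.8 (proof)] -/
theorem apply_eq_zero_of_lt (D : MvPolynomial ι ℝ →ₐ[ℝ] Module.End ℝ (MvPolynomial ι ℝ))
    (hD : ∀ i, D (X i) =
      ((pderiv i : Derivation ℝ (MvPolynomial ι ℝ) (MvPolynomial ι ℝ)) :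
        Module.End ℝ (MvPolynomial ι ℝ)))
    {g p : MvPolynomial ι ℝ} {m k : ℕ} (hg : g.IsHomogeneous m) (hp : p.IsHomogeneous k)
    (hkm : k < m) : D g p = 0 := by
  rw [← sum_homogeneousComponent (D g p)]
  exact Finset.sum_eq_zero fun l _ => homogeneousComponent_apply_eq_zero D hD hg hp (by omega)

omit [Fintype ι] [DecidableEq ι] in
/-- A multiple `a·r` of a homogeneous polynomial `a` of degree `N` has no components of degree `< N`.
[folklore] -/
private theorem homogeneousComponent_mul_eq_zero {a : MvPolynomial ι ℝ} {N : ℕ}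
    (ha : a.IsHomogeneous N) (r : MvPolynomial ι ℝ) {k : ℕ} (hk : k < N) :
    homogeneousComponent k (a * r) = 0 := by
  have hmem : ∀ i, a * homogeneousComponent i r ∈ homogeneousSubmodule ι ℝ (N + i) := fun i =>
    (mem_homogeneousSubmodule _ _).mpr (ha.mul (homogeneousComponent_isHomogeneous i r))
  conv_lhs => rw [← sum_homogeneousComponent r, Finset.mul_sum, map_sum]
  simp_rw [homogeneousComponent_of_mem (hmem _)]
  exact Finset.sum_eq_zero fun i _ => if_neg (by omega)

omit [Fintype ι] [DecidableEq ι] in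
/-- `∂(f)h ∈ ℋ` for `h ∈ ℋ` (the `∂(f)` commute); in particular `ℰ = {∂(g)Δ} ⊆ ℋ` once `Δ ∈ ℋ`.
[cite: GoodmanWallachGTM255, Theorem 5.1.8 (proof: "∂(f)∂(g)Δ(x) = ∂(g)∂(f)Δ(x) = 0 … Hence ℰ ⊂ ℋ")] -/
theorem apply_mem_harmonic (D : MvPolynomial ι ℝ →ₐ[ℝ] Module.End ℝ (MvPolynomial ι ℝ))
    {T : Set (MvPolynomial ι ℝ)} {h : MvPolynomial ι ℝ} (hh : h ∈ ⨅ g ∈ T, LinearMap.ker (D g))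
    (f : MvPolynomial ι ℝ) : D f h ∈ ⨅ g ∈ T, LinearMap.ker (D g) := by
  refine (Submodule.mem_iInf _).mpr fun g => (Submodule.mem_iInf _).mpr fun hg => ?_
  have hgh : D g h = 0 := by
    have := (Submodule.mem_iInf _).mp hh g
    rw [Submodule.mem_iInf] at this
    exact this hg
  rw [LinearMap.mem_ker, ← Module.End.mul_apply, ← map_mul, mul_comm, map_mul,
    Module.End.mul_apply, hgh, map_zero]

omit [Fintype ι] [DecidableEq ι] in
/-- `∂(q)h = 0` for `h ∈ ℋ` and `q` in the ideal `𝒫T` generated by `T`.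
[cite: GoodmanWallachGTM255, Lemma 5.1.9 (proof: "g ∈ φΔ + 𝒫𝒥₊" and "c∂(Δ)Δ = ∂(g)Δ = 0")] -/
theorem apply_eq_zero_of_mem_span (D : MvPolynomial ι ℝ →ₐ[ℝ] Module.End ℝ (MvPolynomial ι ℝ))
    {T : Set (MvPolynomial ι ℝ)} {h : MvPolynomial ι ℝ} (hh : h ∈ ⨅ g ∈ T, LinearMap.ker (D g))
    {q : MvPolynomial ι ℝ} (hq : q ∈ Ideal.span T) : D q h = 0 := by
  induction hq using Submodule.span_induction with
  | mem g hg =>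
    have := (Submodule.mem_iInf _).mp hh g
    rw [Submodule.mem_iInf] at this
    exact this hg
  | zero => rw [map_zero, LinearMap.zero_apply]
  | add a b _ _ ha hb => rw [map_add, LinearMap.add_apply, ha, hb, add_zero]
  | smul a b _ hb => rw [smul_eq_mul, map_mul, Module.End.mul_apply, hb, map_zero]

end operators

/-- **A skew-invariant homogeneous polynomial of degree `< deg Δ` vanishes** (it is divisible by `Δ`).
[cite: GoodmanWallachGTM255, Theorem 5.1.8 (proof: "Hence g(x) is divisible by Δ(x). But g(x) has degree less than the degree of Δ(x), so g = 0")] -/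
theorem eq_zero_of_skew_of_lt {n : ℕ} {q : MvPolynomial (Fin n) ℝ} {k : ℕ} (hq : q.IsHomogeneous k)
    (hskew : ∀ σ : Equiv.Perm (Fin n), rename σ q = ((Equiv.Perm.sign σ : ℤ) : ℝ) • q)
    (hk : k < ∑ i : Fin n, (Finset.Ioi i).card) : q = 0 := by
  obtain ⟨r, hr⟩ := prod_X_sub_X_dvd_of_skew hskew
  have h1 : homogeneousComponent k q = q := by
    rw [homogeneousComponent_of_mem ((mem_homogeneousSubmodule k q).mpr hq), if_pos rfl]
  rw [← h1, hr]
  exact homogeneousComponent_mul_eq_zero (prod_X_sub_X_isHomogeneous n) r hk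

/-- **`Δ` is harmonic**: `∂(f)Δ = 0` for every `f ∈ 𝒥₊` homogeneous (`∂(f)Δ` is skew of degree
`< deg Δ`). [cite: GoodmanWallachGTM255, Theorem 5.1.8 (proof: "Now to prove that Δ(x) is harmonic, take f ∈ 𝒥₊ …")] -/
theorem prod_X_sub_X_mem_harmonic {n : ℕ}
    (D : MvPolynomial (Fin n) ℝ →ₐ[ℝ] Module.End ℝ (MvPolynomial (Fin n) ℝ))
    (hD : ∀ i, D (X i) =
      ((pderiv i : Derivation ℝ (MvPolynomial (Fin n) ℝ) (MvPolynomial (Fin n) ℝ)) :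
        Module.End ℝ (MvPolynomial (Fin n) ℝ))) :
    (∏ i : Fin n, ∏ j ∈ Finset.Ioi i, (X j - X i : MvPolynomial (Fin n) ℝ)) ∈
      ⨅ g ∈ {g : MvPolynomial (Fin n) ℝ | g.IsSymmetric ∧ ∃ d, 0 < d ∧ g.IsHomogeneous d},
        LinearMap.ker (D g) := by
  refine (Submodule.mem_iInf _).mpr fun g => (Submodule.mem_iInf _).mpr fun hg => ?_
  obtain ⟨hgs, d, hd, hgd⟩ := hg
  rw [LinearMap.mem_ker]
  by_cases hdN : d ≤ ∑ i : Fin n, (Finset.Ioi i).card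
  · refine eq_zero_of_skew_of_lt (isHomogeneous_apply D hD hgd (prod_X_sub_X_isHomogeneous n))
      (fun σ => ?_) (by omega)
    rw [rename_apply D hD, hgs σ, rename_prod_X_sub_X, map_smul]
  · exact apply_eq_zero_of_lt D hD hgd (prod_X_sub_X_isHomogeneous n) (by omega)

/-- `∂(Δ)Δ = ⟨Δ | Δ⟩ ≠ 0`. [cite: GoodmanWallachGTM255, Lemma 5.1.9 (proof: "∂(Δ)Δ = ∂(Δ)Δ(0) = ⟨Δ | Δ⟩ ≠ 0")] -/
theorem apply_prod_X_sub_X_self_ne_zero {n : ℕ}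
    (D : MvPolynomial (Fin n) ℝ →ₐ[ℝ] Module.End ℝ (MvPolynomial (Fin n) ℝ))
    (hD : ∀ i, D (X i) =
      ((pderiv i : Derivation ℝ (MvPolynomial (Fin n) ℝ) (MvPolynomial (Fin n) ℝ)) :
        Module.End ℝ (MvPolynomial (Fin n) ℝ))) :
    D (∏ i : Fin n, ∏ j ∈ Finset.Ioi i, (X j - X i : MvPolynomial (Fin n) ℝ))
      (∏ i : Fin n, ∏ j ∈ Finset.Ioi i, (X j - X i)) ≠ 0 := by
  intro h0
  have := fischerInner_apply_right D hD 1 (∏ i : Fin n, ∏ j ∈ Finset.Ioi i, (X j - X i))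
    (∏ i : Fin n, ∏ j ∈ Finset.Ioi i, (X j - X i))
  rw [h0, fischerInner_zero_right, one_mul] at this
  exact prod_X_sub_X_ne_zero n ((fischerInner_self_eq_zero_iff _).mp this.symm)

/-! ## § 4. Lemma 5.1.9 and Theorem 5.1.8 -/

section transpositions

variable {ι : Type*} [Fintype ι] [DecidableEq ι]

omit [Fintype ι] in
/-- **(5.12) for a transposition**: if `(xᵢ − xⱼ)·g ∈ 𝒫𝒥₊` then `g + ρ(s)g ∈ 𝒫𝒥₊` for `s = (i j)`
(apply `1 − ρ(s)` to `fg = Σ u_k v_k`, write `u_k − ρ(s)u_k = f w_k`, and divide by `f`).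
[cite: GoodmanWallachGTM255, Lemma 5.1.9 (proof, display (5.12))] -/
theorem add_rename_swap_mem_span_of_mul_mem {i j : ι} (hij : i ≠ j) {g : MvPolynomial ι ℝ}
    (h : (X i - X j) * g ∈
      Ideal.span {g : MvPolynomial ι ℝ | g.IsSymmetric ∧ ∃ d, 0 < d ∧ g.IsHomogeneous d}) :
    g + rename (Equiv.swap i j) g ∈
      Ideal.span {g : MvPolynomial ι ℝ | g.IsSymmetric ∧ ∃ d, 0 < d ∧ g.IsHomogeneous d} := by
  obtain ⟨m, u, v, huv⟩ := Submodule.mem_span_set'.mp h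
  choose w hw using fun k => X_sub_X_dvd_sub_rename_swap i j (u k)
  have hv : ∀ k, rename (Equiv.swap i j) (v k : MvPolynomial ι ℝ) = v k := fun k =>
    (v k).2.1 (Equiv.swap i j)
  have hf : rename (Equiv.swap i j) (X i - X j : MvPolynomial ι ℝ) = -(X i - X j) := by
    rw [map_sub, rename_X, rename_X, Equiv.swap_apply_left, Equiv.swap_apply_right, neg_sub]
  have h1 := congrArg (rename (Equiv.swap i j)) huv
  rw [map_sum, map_mul, hf] at h1
  simp_rw [smul_eq_mul, map_mul, hv] at h1
  have key : (X i - X j) * (g + rename (Equiv.swap i j) g) =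
      (X i - X j) * ∑ k, w k * (v k : MvPolynomial ι ℝ) := by
    calc (X i - X j) * (g + rename (Equiv.swap i j) g)
        = (X i - X j) * g - -(X i - X j) * rename (Equiv.swap i j) g := by ring
      _ = ∑ k, u k • (v k : MvPolynomial ι ℝ) - ∑ k, rename (Equiv.swap i j) (u k) * v k := by
          rw [huv, h1]
      _ = ∑ k, (u k - rename (Equiv.swap i j) (u k)) * (v k : MvPolynomial ι ℝ) := by
          rw [← Finset.sum_sub_distrib]
          refine Finset.sum_congr rfl fun k _ => ?_
          rw [smul_eq_mul, sub_mul]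
      _ = (X i - X j) * ∑ k, w k * (v k : MvPolynomial ι ℝ) := by
          rw [Finset.mul_sum]
          refine Finset.sum_congr rfl fun k _ => ?_
          rw [hw k, mul_assoc]
  have hne : (X i - X j : MvPolynomial ι ℝ) ≠ 0 := sub_ne_zero.mpr fun e => hij (X_injective e)
  rw [mul_left_cancel₀ hne key]
  exact Submodule.sum_mem _ fun k _ => Ideal.mul_mem_left _ _ (Ideal.subset_span (v k).2)

/-- **(5.12) for all `s ∈ 𝔖ₙ`** by the telescoping argument of Lemma 5.1.6: if `g + ρ(t)g ∈ 𝒫𝒥₊` for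
all transpositions `t`, then `g − sgn(s)ρ(s)g ∈ 𝒫𝒥₊` for all `s`.
[cite: GoodmanWallachGTM255, Lemma 5.1.9 (proof: "By a telescoping sum argument … (5.12) holds for all s ∈ 𝔖ₙ")] -/
theorem sub_sign_smul_rename_mem_span {g : MvPolynomial ι ℝ}
    (h : ∀ i j : ι, i ≠ j → g + rename (Equiv.swap i j) g ∈
      Ideal.span {g : MvPolynomial ι ℝ | g.IsSymmetric ∧ ∃ d, 0 < d ∧ g.IsHomogeneous d})
    (σ : Equiv.Perm ι) :
    g - ((Equiv.Perm.sign σ : ℤ) : ℝ) • rename σ g ∈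
      Ideal.span {g : MvPolynomial ι ℝ | g.IsSymmetric ∧ ∃ d, 0 < d ∧ g.IsHomogeneous d} := by
  induction σ using Equiv.Perm.swap_induction_on with
  | one =>
    rw [Equiv.Perm.sign_one, Units.val_one, Int.cast_one, one_smul, Equiv.Perm.coe_one, rename_id,
      AlgHom.id_apply, sub_self]
    exact Submodule.zero_mem _
  | swap_mul f x y hxy ih =>
    rw [Equiv.Perm.sign_mul, Equiv.Perm.sign_swap hxy, Units.val_mul, Units.val_neg, Units.val_one,
      Int.cast_mul, Int.cast_neg, Int.cast_one, Equiv.Perm.coe_mul, ← rename_rename]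
    have h2 := rename_mem_span (Equiv.swap x y) ih
    rw [map_sub, map_smul] at h2
    convert Submodule.sub_mem _ (h x y hxy) h2 using 1
    rw [neg_one_mul, neg_smul, sub_neg_eq_add]
    abel

end transpositions

/-- **Lemma 5.1.9, the step at degree `m`** (given (5.12) for the transpositions, which the printed
proof gets from the induction hypothesis at degree `m + 1`): average `h = |𝔖ₙ|⁻¹ Σ_s sgn(s)ρ(s)g`, so
`g − h ∈ 𝒫𝒥₊` and `h` is skew, `h = φΔ` with `φ ∈ 𝒥`; then `g ≡ φ(0)·Δ (mod 𝒫𝒥₊)` and applying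
`∂(·)Δ` gives `φ(0)·∂(Δ)Δ = 0`, hence `φ(0) = 0` and `g ∈ 𝒫𝒥₊`.
[cite: GoodmanWallachGTM255, Lemma 5.1.9 (proof, from "(5.12)" to "Hence c = 0 and g ∈ 𝒫𝒥₊")] -/
theorem mem_span_of_forall_add_rename_swap_mem {n : ℕ}
    (D : MvPolynomial (Fin n) ℝ →ₐ[ℝ] Module.End ℝ (MvPolynomial (Fin n) ℝ))
    (hD : ∀ i, D (X i) =
      ((pderiv i : Derivation ℝ (MvPolynomial (Fin n) ℝ) (MvPolynomial (Fin n) ℝ)) :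
        Module.End ℝ (MvPolynomial (Fin n) ℝ)))
    {m : ℕ} {g : MvPolynomial (Fin n) ℝ} (hg : g.IsHomogeneous m)
    (h0 : D g (∏ i : Fin n, ∏ j ∈ Finset.Ioi i, (X j - X i)) = 0)
    (hstep : ∀ i j : Fin n, i ≠ j → g + rename (Equiv.swap i j) g ∈
      Ideal.span {g : MvPolynomial (Fin n) ℝ | g.IsSymmetric ∧ ∃ d, 0 < d ∧ g.IsHomogeneous d}) :
    g ∈ Ideal.span {g : MvPolynomial (Fin n) ℝ | g.IsSymmetric ∧ ∃ d, 0 < d ∧ g.IsHomogeneous d} := by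
  set Δ : MvPolynomial (Fin n) ℝ := ∏ i : Fin n, ∏ j ∈ Finset.Ioi i, (X j - X i) with hΔ
  set I : Ideal (MvPolynomial (Fin n) ℝ) :=
    Ideal.span {g : MvPolynomial (Fin n) ℝ | g.IsSymmetric ∧ ∃ d, 0 < d ∧ g.IsHomogeneous d} with hI
  have hall : ∀ σ : Equiv.Perm (Fin n), g - ((Equiv.Perm.sign σ : ℤ) : ℝ) • rename σ g ∈ I :=
    sub_sign_smul_rename_mem_span hstep
  -- the skew average `h`
  set c : ℝ := (Fintype.card (Equiv.Perm (Fin n)) : ℝ)⁻¹ with hc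
  set h : MvPolynomial (Fin n) ℝ :=
    c • ∑ σ : Equiv.Perm (Fin n), ((Equiv.Perm.sign σ : ℤ) : ℝ) • rename σ g with hh
  have hcard : (Fintype.card (Equiv.Perm (Fin n)) : ℝ) ≠ 0 := Nat.cast_ne_zero.mpr Fintype.card_ne_zero
  -- `g − h ∈ 𝒫𝒥₊`
  have hgh : g - h ∈ I := by
    have e : g - h = c • ∑ σ : Equiv.Perm (Fin n), (g - ((Equiv.Perm.sign σ : ℤ) : ℝ) • rename σ g) := by
      rw [Finset.sum_sub_distrib, Finset.sum_const, Finset.card_univ, smul_sub, ← Nat.cast_smul_eq_nsmul ℝ,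
        smul_smul, hc, inv_mul_cancel₀ hcard, one_smul]
    rw [e]
    exact Submodule.smul_of_tower_mem _ c (Submodule.sum_mem _ fun σ _ => hall σ)
  -- `h` is skew invariant and homogeneous of degree `m`
  have hskew : ∀ τ : Equiv.Perm (Fin n), rename τ h = ((Equiv.Perm.sign τ : ℤ) : ℝ) • h := by
    intro τ
    have hτ2 : ((Equiv.Perm.sign τ : ℤ) : ℝ) * ((Equiv.Perm.sign τ : ℤ) : ℝ) = 1 := by
      rw [← Int.cast_mul, ← Units.val_mul, Int.units_mul_self, Units.val_one, Int.cast_one]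
    rw [hh, map_smul, smul_comm (((Equiv.Perm.sign τ : ℤ) : ℝ)) c]
    congr 1
    rw [map_sum, Finset.smul_sum]
    simp_rw [map_smul, rename_rename]
    refine Fintype.sum_equiv (Equiv.mulLeft τ) _ _ fun σ => ?_
    simp only [Equiv.coe_mulLeft]
    rw [Equiv.Perm.sign_mul, Units.val_mul, Int.cast_mul, smul_smul, ← mul_assoc, hτ2, one_mul,
      Equiv.Perm.coe_mul]
  have hhm : h.IsHomogeneous m := by
    rw [← mem_homogeneousSubmodule]
    refine Submodule.smul_mem _ _ (Submodule.sum_mem _ fun σ _ => Submodule.smul_mem _ _ ?_)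
    exact (mem_homogeneousSubmodule _ _).mpr hg.rename_isHomogeneous
  -- `h = Δ φ` with `φ ∈ 𝒥`
  obtain ⟨φ, hφ⟩ := prod_X_sub_X_dvd_of_skew hskew
  have hφs : φ.IsSymmetric := by
    intro τ
    have e1 := hskew τ
    rw [hφ, map_mul, rename_prod_X_sub_X, smul_mul_assoc, ← hΔ] at e1
    have hs : ((Equiv.Perm.sign τ : ℤ) : ℝ) ≠ 0 := Int.cast_ne_zero.mpr (Units.ne_zero _)
    exact mul_left_cancel₀ (prod_X_sub_X_ne_zero n) (smul_right_injective _ hs e1)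
  -- `g ≡ φ(0) Δ mod 𝒫𝒥₊`
  have hgc : g - coeff 0 φ • Δ ∈ I := by
    have e : g - coeff 0 φ • Δ = (g - h) + Δ * (φ - C (coeff 0 φ)) := by
      rw [hφ, MvPolynomial.smul_eq_C_mul]
      ring
    rw [e]
    exact I.add_mem hgh (I.mul_mem_left Δ (sub_C_mem_span hφs))
  -- apply `∂(·)Δ`
  have e2 := apply_eq_zero_of_mem_span D (prod_X_sub_X_mem_harmonic D hD) hgc
  rw [map_sub, LinearMap.sub_apply, ← hΔ, h0, zero_sub, map_smul, LinearMap.smul_apply, neg_eq_zero,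
    smul_eq_zero] at e2
  rcases e2 with hc0 | hΔΔ
  · rw [hc0, zero_smul, sub_zero] at hgc
    exact hgc
  · exact absurd hΔΔ (apply_prod_X_sub_X_self_ne_zero D hD)

/-- **Lemma 5.1.9 (Goodman–Wallach).** If `g ∈ 𝒫ᵐ` and `∂(g)Δ = 0` then `g ∈ (𝒫𝒥₊)ᵐ` — by downward
induction on `m`: for `m > n(n−1)/2`, `𝒫ᵐ = (𝒫𝒥₊)ᵐ` since `ℋᵐ = 0` (Lemma 5.1.5, Corollary 5.1.7);
the step uses `f = xᵢ − xⱼ`, `∂(fg)Δ = ∂(f)∂(g)Δ = 0`, and (5.12).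
[cite: GoodmanWallachGTM255, Lemma 5.1.9] -/
theorem mem_span_of_apply_prod_X_sub_X_eq_zero {n : ℕ}
    (D : MvPolynomial (Fin n) ℝ →ₐ[ℝ] Module.End ℝ (MvPolynomial (Fin n) ℝ))
    (hD : ∀ i, D (X i) =
      ((pderiv i : Derivation ℝ (MvPolynomial (Fin n) ℝ) (MvPolynomial (Fin n) ℝ)) :
        Module.End ℝ (MvPolynomial (Fin n) ℝ)))
    {m : ℕ} {g : MvPolynomial (Fin n) ℝ} (hg : g.IsHomogeneous m)
    (h0 : D g (∏ i : Fin n, ∏ j ∈ Finset.Ioi i, (X j - X i)) = 0) :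
    g ∈ Ideal.span {g : MvPolynomial (Fin n) ℝ | g.IsSymmetric ∧ ∃ d, 0 < d ∧ g.IsHomogeneous d} := by
  suffices H : ∀ k m : ℕ, n * (n - 1) / 2 + 1 ≤ m + k → ∀ g : MvPolynomial (Fin n) ℝ,
      g.IsHomogeneous m → D g (∏ i : Fin n, ∏ j ∈ Finset.Ioi i, (X j - X i)) = 0 →
      g ∈ Ideal.span {g : MvPolynomial (Fin n) ℝ | g.IsSymmetric ∧ ∃ d, 0 < d ∧ g.IsHomogeneous d} from
    H (n * (n - 1) / 2 + 1) m (by omega) g hg h0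
  intro k
  induction k with
  | zero =>
    -- `m > n(n−1)/2`: `𝒫ᵐ = ℋᵐ ⊕ (𝒫𝒥₊)ᵐ` with `ℋᵐ = 0`
    intro m hm g hg _
    obtain ⟨h, q, hh, hharm, -, hq, rfl⟩ := exists_harmonic_add_mem_span D hD
      (S := {g : MvPolynomial (Fin n) ℝ | g.IsSymmetric ∧ ∃ d, 0 < d ∧ g.IsHomogeneous d})
      (fun g hg => hg.2.imp fun d hd => hd.2) hg
    have hbot := harmonic_inf_eq_bot_of_lt D hD (d := m) (by rw [Fintype.card_fin]; omega)
    have hmem : h ∈ homogeneousSubmodule (Fin n) ℝ m ⊓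
        ⨅ g ∈ {g : MvPolynomial (Fin n) ℝ | g.IsSymmetric ∧ ∃ d, 0 < d ∧ g.IsHomogeneous d},
          LinearMap.ker (D g) := by
      refine ⟨(mem_homogeneousSubmodule m h).mpr hh, (Submodule.mem_iInf _).mpr fun g =>
        (Submodule.mem_iInf _).mpr fun hg => ?_⟩
      exact hharm g hg
    rw [hbot, Submodule.mem_bot] at hmem
    rw [hmem, zero_add]
    exact hq
  | succ k ih =>
    intro m hm g hg h0
    by_cases hm' : n * (n - 1) / 2 + 1 ≤ m + k
    · exact ih m hm' g hg h0
    · refine mem_span_of_forall_add_rename_swap_mem D hD hg h0 fun i j hij => ?_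
      refine add_rename_swap_mem_span_of_mul_mem hij (ih (m + 1) (by omega) _ ?_ ?_)
      · rw [add_comm]
        exact ((isHomogeneous_X ℝ i).sub (isHomogeneous_X ℝ j)).mul hg
      · rw [map_mul, Module.End.mul_apply, h0, map_zero]

/-- **Proof of Theorem 5.1.8, injectivity**: if `h ∈ ℋ` and `∂(h)Δ = 0` then `h = 0` (each homogeneous
component `h_m` has `∂(h_m)Δ = 0`, so `h_m ∈ ℋᵐ ∩ (𝒫𝒥₊)ᵐ = 0` by Lemmas 5.1.9 and 5.1.5).
[cite: GoodmanWallachGTM255, Theorem 5.1.8 (proof: "Consider the map ℋ → ℰ given by h ↦ ∂(h)Δ …")] -/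
theorem eq_zero_of_mem_harmonic_of_apply_eq_zero {n : ℕ}
    (D : MvPolynomial (Fin n) ℝ →ₐ[ℝ] Module.End ℝ (MvPolynomial (Fin n) ℝ))
    (hD : ∀ i, D (X i) =
      ((pderiv i : Derivation ℝ (MvPolynomial (Fin n) ℝ) (MvPolynomial (Fin n) ℝ)) :
        Module.End ℝ (MvPolynomial (Fin n) ℝ)))
    {h : MvPolynomial (Fin n) ℝ}
    (hh : h ∈ ⨅ g ∈ {g : MvPolynomial (Fin n) ℝ | g.IsSymmetric ∧ ∃ d, 0 < d ∧ g.IsHomogeneous d},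
      LinearMap.ker (D g))
    (h0 : D h (∏ i : Fin n, ∏ j ∈ Finset.Ioi i, (X j - X i)) = 0) : h = 0 := by
  set Δ : MvPolynomial (Fin n) ℝ := ∏ i : Fin n, ∏ j ∈ Finset.Ioi i, (X j - X i) with hΔ
  set N : ℕ := ∑ i : Fin n, (Finset.Ioi i).card with hN
  have hΔh : Δ.IsHomogeneous N := prod_X_sub_X_isHomogeneous n
  -- `∂(h_m)Δ = 0` for every `m`
  have hcomp : ∀ m, D (homogeneousComponent m h) Δ = 0 := by
    intro m
    by_cases hmN : m ≤ N
    · have e1 : D h Δ = ∑ l ∈ Finset.range (h.totalDegree + 1), D (homogeneousComponent l h) Δ := by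
        conv_lhs => rw [← sum_homogeneousComponent h]
        rw [map_sum, LinearMap.sum_apply]
      have e2 : ∀ l, homogeneousComponent (N - m) (D (homogeneousComponent l h) Δ) =
          if l = m then D (homogeneousComponent l h) Δ else 0 := by
        intro l
        by_cases hl : l ≤ N
        · rw [homogeneousComponent_of_mem ((mem_homogeneousSubmodule _ _).mpr
            (isHomogeneous_apply D hD (homogeneousComponent_isHomogeneous l h) hΔh))]
          by_cases hlm : l = m
          · rw [if_pos (by omega), if_pos hlm]
          · rw [if_neg (by omega), if_neg hlm]
        · rw [apply_eq_zero_of_lt D hD (homogeneousComponent_isHomogeneous l h) hΔh (by omega),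
            map_zero, if_neg (by omega)]
      have e3 := congrArg (homogeneousComponent (N - m)) e1
      rw [h0, map_zero, map_sum] at e3
      simp_rw [e2] at e3
      simp only [Finset.sum_ite_eq', Finset.mem_range] at e3
      split_ifs at e3 with hmr
      · exact e3.symm
      · rw [homogeneousComponent_eq_zero m h (by omega), map_zero, LinearMap.zero_apply]
    · exact apply_eq_zero_of_lt D hD (homogeneousComponent_isHomogeneous m h) hΔh (by omega)
  -- each component lies in `ℋ ∩ 𝒫𝒥₊ = 0`
  have hzero : ∀ m, homogeneousComponent m h = 0 := fun m =>
    (Submodule.disjoint_def.mp (disjoint_harmonic_span D hD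
      {g : MvPolynomial (Fin n) ℝ | g.IsSymmetric ∧ ∃ d, 0 < d ∧ g.IsHomogeneous d})) _
      (homogeneousComponent_mem_harmonic D hD hh m)
      (mem_span_of_apply_prod_X_sub_X_eq_zero D hD (homogeneousComponent_isHomogeneous m h) (hcomp m))
  rw [← sum_homogeneousComponent h]
  exact Finset.sum_eq_zero fun m _ => hzero m

/-- **Theorem 5.1.8 (Goodman–Wallach).** The `𝔖ₙ`-harmonic polynomials are exactly the polynomials
`∂(g)Δ`, `g ∈ 𝒫`: `ℋ = ℰ = {∂(g)Δ : g ∈ 𝒫}` (`ℰ ⊆ ℋ` since `Δ ∈ ℋ`; `h ↦ ∂(h)Δ` is injective on `ℋ`,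
so `dim ℋ ≤ dim ℰ`, and `ℋ` is finite-dimensional). [cite: GoodmanWallachGTM255, Theorem 5.1.8] -/
theorem mem_harmonic_iff_exists_apply_prod_X_sub_X {n : ℕ}
    (D : MvPolynomial (Fin n) ℝ →ₐ[ℝ] Module.End ℝ (MvPolynomial (Fin n) ℝ))
    (hD : ∀ i, D (X i) =
      ((pderiv i : Derivation ℝ (MvPolynomial (Fin n) ℝ) (MvPolynomial (Fin n) ℝ)) :
        Module.End ℝ (MvPolynomial (Fin n) ℝ)))
    (h : MvPolynomial (Fin n) ℝ) :
    h ∈ (⨅ g ∈ {g : MvPolynomial (Fin n) ℝ | g.IsSymmetric ∧ ∃ d, 0 < d ∧ g.IsHomogeneous d},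
        LinearMap.ker (D g)) ↔
      ∃ g : MvPolynomial (Fin n) ℝ, D g (∏ i : Fin n, ∏ j ∈ Finset.Ioi i, (X j - X i)) = h := by
  set Δ : MvPolynomial (Fin n) ℝ := ∏ i : Fin n, ∏ j ∈ Finset.Ioi i, (X j - X i) with hΔ
  set H : Submodule ℝ (MvPolynomial (Fin n) ℝ) :=
    ⨅ g ∈ {g : MvPolynomial (Fin n) ℝ | g.IsSymmetric ∧ ∃ d, 0 < d ∧ g.IsHomogeneous d},
      LinearMap.ker (D g) with hH
  have hΔH : Δ ∈ H := prod_X_sub_X_mem_harmonic D hD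
  -- `ℰ = range (g ↦ ∂(g)Δ) ⊆ ℋ`
  let Φ : MvPolynomial (Fin n) ℝ →ₗ[ℝ] MvPolynomial (Fin n) ℝ :=
    (LinearMap.applyₗ Δ).comp D.toLinearMap
  have hΦ : ∀ g, Φ g = D g Δ := fun g => rfl
  have hEH : LinearMap.range Φ ≤ H := by
    rintro _ ⟨g, rfl⟩
    exact apply_mem_harmonic D hΔH g
  haveI : Module.Finite ℝ H := finite_harmonic D hD
  haveI : Module.Finite ℝ (LinearMap.range Φ) :=
    Module.Finite.of_injective (Submodule.inclusion hEH) (Submodule.inclusion_injective hEH)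
  -- `h ↦ ∂(h)Δ` is injective on `ℋ`, so `dim ℋ ≤ dim ℰ`
  let Ψ : H →ₗ[ℝ] LinearMap.range Φ :=
    (Φ.domRestrict H).codRestrict (LinearMap.range Φ) fun x => ⟨x, rfl⟩
  have hΨ : Function.Injective Ψ := by
    intro x y hxy
    apply Subtype.ext
    have e : Φ (x - y : H) = 0 := by
      have := congrArg Subtype.val hxy
      simp only [Ψ, LinearMap.codRestrict_apply, LinearMap.domRestrict_apply] at this
      rw [Submodule.coe_sub, map_sub, sub_eq_zero]
      exact this
    exact sub_eq_zero.mp (eq_zero_of_mem_harmonic_of_apply_eq_zero D hD (x - y).2 e)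
  have hle : Module.finrank ℝ H ≤ Module.finrank ℝ (LinearMap.range Φ) :=
    LinearMap.finrank_le_finrank_of_injective hΨ
  have hEq : LinearMap.range Φ = H := Submodule.eq_of_le_of_finrank_le hEH hle
  constructor
  · intro hh
    rw [← hEq] at hh
    obtain ⟨g, hg⟩ := LinearMap.mem_range.mp hh
    exact ⟨g, hg⟩
  · rintro ⟨g, rfl⟩
    exact apply_mem_harmonic D hΔH g

/-- **Theorem 5.1.8, as printed: "`ℋ` is spanned by `Δ(x)` and its partial derivatives of all
orders"** — `ℋ = Span_ℝ {∂(x^α)Δ : α}` (`∂(x^α) = ∏ ∂ᵢ^{αᵢ}`).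
[cite: GoodmanWallachGTM255, Theorem 5.1.8] -/
theorem harmonic_eq_span_apply_monomial_prod_X_sub_X {n : ℕ}
    (D : MvPolynomial (Fin n) ℝ →ₐ[ℝ] Module.End ℝ (MvPolynomial (Fin n) ℝ))
    (hD : ∀ i, D (X i) =
      ((pderiv i : Derivation ℝ (MvPolynomial (Fin n) ℝ) (MvPolynomial (Fin n) ℝ)) :
        Module.End ℝ (MvPolynomial (Fin n) ℝ))) :
    (⨅ g ∈ {g : MvPolynomial (Fin n) ℝ | g.IsSymmetric ∧ ∃ d, 0 < d ∧ g.IsHomogeneous d},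
        LinearMap.ker (D g)) =
      Submodule.span ℝ (Set.range fun α : Fin n →₀ ℕ =>
        D (monomial α 1) (∏ i : Fin n, ∏ j ∈ Finset.Ioi i, (X j - X i))) := by
  apply le_antisymm
  · intro h hh
    obtain ⟨g, rfl⟩ := (mem_harmonic_iff_exists_apply_prod_X_sub_X D hD h).mp hh
    rw [g.as_sum, map_sum, LinearMap.sum_apply]
    refine Submodule.sum_mem _ fun α _ => ?_
    rw [show monomial α (coeff α g) = coeff α g • monomial α (1 : ℝ) by
      rw [smul_monomial, smul_eq_mul, mul_one], map_smul, LinearMap.smul_apply]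
    exact Submodule.smul_mem _ _ (Submodule.subset_span ⟨α, rfl⟩)
  · rw [Submodule.span_le]
    rintro _ ⟨α, rfl⟩
    exact apply_mem_harmonic D (prod_X_sub_X_mem_harmonic D hD) _

/-! ### The top degree: `ℋ^{n(n−1)/2} = ℝΔ` -/

/-- `deg (1 + t + ⋯ + tᵏ) = k`. [folklore] -/
private theorem natDegree_geom_sum_X (k : ℕ) :
    (∑ i ∈ Finset.range (k + 1), (Polynomial.X : Polynomial ℤ) ^ i).natDegree = k := by
  refine le_antisymm (Polynomial.natDegree_sum_le_of_forall_le _ _ fun i hi =>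
    (Polynomial.natDegree_X_pow_le i).trans (Nat.lt_succ_iff.mp (Finset.mem_range.mp hi))) ?_
  refine Polynomial.le_natDegree_of_ne_zero ?_
  rw [Polynomial.finsetSum_coeff]
  simp_rw [Polynomial.coeff_X_pow]
  rw [Finset.sum_ite_eq, if_pos (Finset.mem_range.mpr (Nat.lt_succ_self k))]
  exact one_ne_zero

/-- The leading coefficient of `p_ℋ(t) = ∏_{k=1}^{n} (1 + t + ⋯ + t^{k−1})` is `1`, in degree `n(n−1)/2`
("`p_ℋ(t) = t^{n(n−1)/2} + ⋯`"). [cite: GoodmanWallachGTM255, Corollary 5.1.7 (remark after the proof)] -/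
theorem coeff_prod_geom_sum_top (n : ℕ) :
    (∏ k ∈ Finset.range n, ∑ i ∈ Finset.range (k + 1), (Polynomial.X : Polynomial ℤ) ^ i).coeff
      (n * (n - 1) / 2) = 1 := by
  have hmon : ∀ k ∈ Finset.range n,
      (∑ i ∈ Finset.range (k + 1), (Polynomial.X : Polynomial ℤ) ^ i).Monic := fun k _ =>
    Polynomial.monic_geom_sum_X (Nat.succ_ne_zero k)
  have hdeg : (∏ k ∈ Finset.range n,
      ∑ i ∈ Finset.range (k + 1), (Polynomial.X : Polynomial ℤ) ^ i).natDegree = n * (n - 1) / 2 := by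
    rw [Polynomial.natDegree_prod_of_monic _ _ hmon]
    simp_rw [natDegree_geom_sum_X]
    exact Finset.sum_range_id n
  rw [← hdeg]
  exact (Polynomial.monic_prod_of_monic _ _ hmon).coeff_natDegree

/-- **"There is a unique (up to a constant multiple) polynomial in `ℋ` of degree `n(n−1)/2`"**, and it
is `Δ`: `ℋ ∩ 𝒫^{n(n−1)/2} = ℝΔ` (`dim ℋ^{n(n−1)/2} = 1` by Corollary 5.1.7, and `0 ≠ Δ ∈ ℋ` is
homogeneous of that degree). [cite: GoodmanWallachGTM255, §5.1.2, remark before Theorem 5.1.8 and Theorem 5.1.8] -/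
theorem homogeneousSubmodule_inf_harmonic_eq_span_prod_X_sub_X {n : ℕ}
    (D : MvPolynomial (Fin n) ℝ →ₐ[ℝ] Module.End ℝ (MvPolynomial (Fin n) ℝ))
    (hD : ∀ i, D (X i) =
      ((pderiv i : Derivation ℝ (MvPolynomial (Fin n) ℝ) (MvPolynomial (Fin n) ℝ)) :
        Module.End ℝ (MvPolynomial (Fin n) ℝ))) :
    homogeneousSubmodule (Fin n) ℝ (n * (n - 1) / 2) ⊓
        ⨅ g ∈ {g : MvPolynomial (Fin n) ℝ | g.IsSymmetric ∧ ∃ d, 0 < d ∧ g.IsHomogeneous d},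
          LinearMap.ker (D g) =
      Submodule.span ℝ {∏ i : Fin n, ∏ j ∈ Finset.Ioi i, (X j - X i : MvPolynomial (Fin n) ℝ)} := by
  have hΔmem : (∏ i : Fin n, ∏ j ∈ Finset.Ioi i, (X j - X i : MvPolynomial (Fin n) ℝ)) ∈
      homogeneousSubmodule (Fin n) ℝ (n * (n - 1) / 2) ⊓
        ⨅ g ∈ {g : MvPolynomial (Fin n) ℝ | g.IsSymmetric ∧ ∃ d, 0 < d ∧ g.IsHomogeneous d},
          LinearMap.ker (D g) :=
    ⟨(mem_homogeneousSubmodule _ _).mpr (sum_card_Ioi_eq n ▸ prod_X_sub_X_isHomogeneous n),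
      prod_X_sub_X_mem_harmonic D hD⟩
  haveI := finite_harmonic D hD (ι := Fin n)
  haveI : Module.Finite ℝ ↥(homogeneousSubmodule (Fin n) ℝ (n * (n - 1) / 2) ⊓
      ⨅ g ∈ {g : MvPolynomial (Fin n) ℝ | g.IsSymmetric ∧ ∃ d, 0 < d ∧ g.IsHomogeneous d},
        LinearMap.ker (D g)) :=
    Module.Finite.of_injective (Submodule.inclusion inf_le_right) (Submodule.inclusion_injective _)
  have hfin : Module.finrank ℝ ↥(homogeneousSubmodule (Fin n) ℝ (n * (n - 1) / 2) ⊓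
      ⨅ g ∈ {g : MvPolynomial (Fin n) ℝ | g.IsSymmetric ∧ ∃ d, 0 < d ∧ g.IsHomogeneous d},
        LinearMap.ker (D g)) = 1 := by
    have := finrank_harmonic_inf_eq_coeff D hD (ι := Fin n) (n * (n - 1) / 2)
    rw [Fintype.card_fin, coeff_prod_geom_sum_top] at this
    exact_mod_cast this
  symm
  refine Submodule.eq_of_le_of_finrank_le ((Submodule.span_singleton_le_iff_mem _ _).mpr hΔmem) ?_
  rw [hfin, finrank_span_singleton (prod_X_sub_X_ne_zero n)]

end

end Literature.RepresentationTheory.ClassicalInvariants.SymmetricGroupHarmonicsVandermonde
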